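import Literature.NumberTheory.QuadraticFields.HurwitzClassNumberCongruences
import Literature.NumberTheory.EllipticCurves.Rank1Residual.Typed.X12
import Literature.NumberTheory.EllipticCurves.HeegnerPoints
import Literature.NumberTheory.EllipticCurves.QuadraticTwist
import Literature.NumberTheory.EllipticCurves.AnalyticRank
import HarnessLib

set_option linter.dupNamespace false -- `Summit.BirchSwinnertonDyer.BirchSwinnertonDyer.Theorems.…` (summit = sub, D-0017)
set_option autoImplicit false

/-!
# Crux KS_R `HeegnerFieldSupplyCMInertBadKPrime` (stmt-BirchSwinnertonDyer-20713) of route `BiquadraticEisensteinDescent`: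
# the composition «children ⇒ KS_R» BY VALUE — the `--glue-by` target for the route author's planned split

Seat `bsd-wall-bed-p3` (prover g2, cell `pub/bsd-wall`), 2026-08-27. THEOREMS ONLY (no definition, no named fact,
no `sorry`); imports NO `Theses` module (every statement is spelled out), so the route file may reference the theorem
below by `--glue-by` without an import cycle.

The route author's split package for KS_R (bsd-wall-cm g10, `HOME/bsd-wall-cm/g10/children-KSR-g10.json`, certificate
`g10/SplitCheckKSR-g10.lean`; re-run against the LANDED print-input file p553658
`Literature/NumberTheory/QuadraticFields/HurwitzClassNumberCongruences.lean` as `HOME/bsd-wall-bed-p3/g2/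
SplitCheckKSR-landed.lean`, rc 0) cuts KS_R into four children:

* C1 = the named fact `Literature.NumberTheory.QuadraticFields.BRR2020_thm_1` (Beckwith–Raum–Richter, PNAS 2020,
  Thm. 1: a non-holomorphic Ramanujan-type congruence `H(an+b) ≡ 0 (mod ℓ)` forces `ℓ ∣ a`);
* C2 = the named fact `Literature.NumberTheory.QuadraticFields.BRR2022_thm_1` (Adv. Math. 2022, Thm. 1: `ℓ ∣ b`);
* C3 = `HeegnerClassNumberSupplyOfPrint`: granted C1 and C2, for every prime `ℓ ≥ 5`, level `N ≠ 0` and bound `B` there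
  is an imaginary quadratic `K` with `B < |d_K|`, `4 < |d_K|`, the Heegner hypothesis for `N` and `ℓ ∤ h_K` (the
  class-number half of the supply — the prover target «T2»);
* C4 = `HeegnerTwistCouplingInSupply` (= registered `stub_KSR2` verbatim): inside that unbounded family one field also has
  `L(W^{(d_K)}, 1) ≠ 0` — the whole open content of KS_R.

`heegnerFieldSupplyCMInertBadKPrime_of_children : C1 → C2 → C3 → C4 → KS_R` (all five texts by value, the children
verbatim from `HOME/bsd-wall-bed-p3/g2/children-KSR-landed.json`, KS_R verbatim from the route file rev 22) is three lines
of logic: instantiate C3 at `ℓ = p`, `N = N_W`, feed the family to C4. CONDITIONAL on nothing; it asserts nothing about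
C3, C4 or BSD — it is the glue, so that the split can be filed `--glue-by` this theorem (no glue item, no extra vet).

References: [BeckwithRaumRichter2020] O. Beckwith, M. Raum, O. K. Richter, PNAS 117 (2020), Thm. 1;
[BeckwithRaumRichter2022] Adv. Math. 409 (2022) 108663, Thm. 1; [GrossZagier1986] B. Gross, D. Zagier, Invent. Math. 84
(1986) §I.1 (Heegner hypothesis).
-/

noncomputable section

open scoped NumberField
open WeierstrassCurve NumberField
  Literature.NumberTheory.EllipticCurves Literature.NumberTheory.EllipticCurves.Rank1Residual

namespace Summit.BirchSwinnertonDyer.BirchSwinnertonDyer.Theorems.BiquadraticEisensteinDescentHeegnerFieldSupplyKPrimeOfChildren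

/-- **KS_R from its four planned children, BY VALUE** (the `--glue-by` target). Hypotheses, in order: C1 =
`BRR2020_thm_1` (as the child states it: the bare named fact), C2 = `BRR2022_thm_1`, C3 = the class-number half of the
Heegner-field supply for every level granted C1/C2, C4 = the twist coupling inside the supplied family (= `stub_KSR2`);
conclusion = the text of `Theses.BiquadraticEisensteinDescent.HeegnerFieldSupplyCMInertBadKPrime` (rev 22) verbatim.
Proof: C4 applied to the family `B ↦ C3 C1 C2 p N_W B`. [cite: BeckwithRaumRichter2022, Thm. 1]
[cite: GrossZagier1986, §I.1] -/
theorem heegnerFieldSupplyCMInertBadKPrime_of_children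
    (h1 : Literature.NumberTheory.QuadraticFields.BRR2020_thm_1)
    (h2 : Literature.NumberTheory.QuadraticFields.BRR2022_thm_1)
    (h3 : Literature.NumberTheory.QuadraticFields.BRR2020_thm_1 →
      Literature.NumberTheory.QuadraticFields.BRR2022_thm_1 →
      ∀ (ℓ N B : ℕ), ℓ.Prime → 5 ≤ ℓ → N ≠ 0 →
        ∃ (K : Type) (_ : Field K) (_ : NumberField K),
          Literature.NumberTheory.EllipticCurves.IsImaginaryQuadratic K ∧
          B < (NumberField.discr K).natAbs ∧ 4 < (NumberField.discr K).natAbs ∧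
          Literature.NumberTheory.EllipticCurves.SatisfiesHeegnerHypothesis N K ∧ ¬ ℓ ∣ NumberField.classNumber K)
    (h4 : ∀ (W : WeierstrassCurve ℚ) [W.IsElliptic] [W.IsGloballyMinimal] (p : ℕ) [Fact p.Prime]
      [NeZero (W.conductorNorm ℤ)],
      W.HasCM → W.analyticRank = 1 → 5 ≤ p →
      Literature.NumberTheory.EllipticCurves.Rank1Residual.CMInert W p →
      ¬ Literature.NumberTheory.EllipticCurves.Rank1Residual.Good W p →
      (∀ B : ℕ, ∃ (K : Type) (_ : Field K) (_ : NumberField K),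
        Literature.NumberTheory.EllipticCurves.IsImaginaryQuadratic K ∧ B < (NumberField.discr K).natAbs ∧
        4 < (NumberField.discr K).natAbs ∧
        Literature.NumberTheory.EllipticCurves.SatisfiesHeegnerHypothesis (W.conductorNorm ℤ) K ∧
        ¬ p ∣ NumberField.classNumber K) →
      ∃ (K : Type) (_ : Field K) (_ : NumberField K),
        Literature.NumberTheory.EllipticCurves.IsImaginaryQuadratic K ∧ 4 < (NumberField.discr K).natAbs ∧
        Literature.NumberTheory.EllipticCurves.SatisfiesHeegnerHypothesis (W.conductorNorm ℤ) K ∧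
        (W.quadraticTwist (NumberField.discr K : ℚ)).entireLFunction 1 ≠ 0 ∧
        ¬ p ∣ NumberField.classNumber K) :
    ∀ (W : WeierstrassCurve ℚ) [W.IsElliptic] [W.IsGloballyMinimal] (p : ℕ) [Fact p.Prime]
      [NeZero (W.conductorNorm ℤ)], W.HasCM → W.analyticRank = 1 → 5 ≤ p →
      Literature.NumberTheory.EllipticCurves.Rank1Residual.CMInert W p →
      ¬ Literature.NumberTheory.EllipticCurves.Rank1Residual.Good W p →
      ∃ (K : Type) (_ : Field K) (_ : NumberField K),
        Literature.NumberTheory.EllipticCurves.IsImaginaryQuadratic K ∧ 4 < (NumberField.discr K).natAbs ∧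
        Literature.NumberTheory.EllipticCurves.SatisfiesHeegnerHypothesis (W.conductorNorm ℤ) K ∧
        (W.quadraticTwist (NumberField.discr K : ℚ)).entireLFunction 1 ≠ 0 ∧ ¬ p ∣ NumberField.classNumber K := by
  intro W _ _ p _ _ hCM hr hp5 hin hbad
  exact h4 W p hCM hr hp5 hin hbad fun B ↦ h3 h1 h2 p (W.conductorNorm ℤ) B Fact.out hp5 (NeZero.ne _)

/-! ### §2 (appended, bed-p3 g2 18:4xZ) The same composition for the two other cuts on the table

The route author's successor (bsd-wall-cm g11, STATUS 18:21:22Z) announced a THREE-child cut instead — «BRR2022 print input ·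
class-number supply `…OfPrint` = `BRR2022_thm_1 → <stub_KSR1 verbatim>` (closable by bed-p2 g7's `ksr1_of_brr2022`, p555038) ·
coupling crux = `stub_KSR2` verbatim» — and the registered skeleton 43cf659541f04013 (cm g9) is the TWO-stub cut
`stub_KSR1`, `stub_KSR2`. So that a `--glue-by` target exists whichever cut is filed, the two corresponding compositions
are recorded here, again with every text BY VALUE (`stub_KSR1` / `stub_KSR2` = the registered signatures on
stmt-BirchSwinnertonDyer-20713 with names fully qualified; KS_R = the route text rev 22). Pure logic; nothing is asserted
about the stubs, the print input, or BSD. -/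

/-- **KS_R from the three-child cut** announced by cm g11: C1′ = the bare named fact `BRR2022_thm_1` (Beckwith–Raum–Richter,
Adv. Math. 2022, Thm. 1), C2′ = `BRR2022_thm_1 → <stub_KSR1 verbatim>` (the class-number half of the supply for THIS `(W, p)`,
unbounded in `|d_K|`), C3′ = `<stub_KSR2 verbatim>` (the twist coupling inside the supplied family). Proof: C3′ fed with
`C2′ C1′`. [cite: BeckwithRaumRichter2022, Thm. 1] [cite: GrossZagier1986, §I.1] -/
theorem heegnerFieldSupplyCMInertBadKPrime_of_children3
    (h1 : Literature.NumberTheory.QuadraticFields.BRR2022_thm_1)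
    (h2 : Literature.NumberTheory.QuadraticFields.BRR2022_thm_1 →
      ∀ (W : WeierstrassCurve ℚ) [W.IsElliptic] [W.IsGloballyMinimal] (p : ℕ) [Fact p.Prime]
        [NeZero (W.conductorNorm ℤ)], W.HasCM → W.analyticRank = 1 → 5 ≤ p →
        Literature.NumberTheory.EllipticCurves.Rank1Residual.CMInert W p →
        ¬ Literature.NumberTheory.EllipticCurves.Rank1Residual.Good W p →
        ∀ B : ℕ, ∃ (K : Type) (_ : Field K) (_ : NumberField K),
          Literature.NumberTheory.EllipticCurves.IsImaginaryQuadratic K ∧ B < (NumberField.discr K).natAbs ∧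
          4 < (NumberField.discr K).natAbs ∧
          Literature.NumberTheory.EllipticCurves.SatisfiesHeegnerHypothesis (W.conductorNorm ℤ) K ∧
          ¬ p ∣ NumberField.classNumber K)
    (h3 : ∀ (W : WeierstrassCurve ℚ) [W.IsElliptic] [W.IsGloballyMinimal] (p : ℕ) [Fact p.Prime]
      [NeZero (W.conductorNorm ℤ)],
      W.HasCM → W.analyticRank = 1 → 5 ≤ p →
      Literature.NumberTheory.EllipticCurves.Rank1Residual.CMInert W p →
      ¬ Literature.NumberTheory.EllipticCurves.Rank1Residual.Good W p →
      (∀ B : ℕ, ∃ (K : Type) (_ : Field K) (_ : NumberField K),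
        Literature.NumberTheory.EllipticCurves.IsImaginaryQuadratic K ∧ B < (NumberField.discr K).natAbs ∧
        4 < (NumberField.discr K).natAbs ∧
        Literature.NumberTheory.EllipticCurves.SatisfiesHeegnerHypothesis (W.conductorNorm ℤ) K ∧
        ¬ p ∣ NumberField.classNumber K) →
      ∃ (K : Type) (_ : Field K) (_ : NumberField K),
        Literature.NumberTheory.EllipticCurves.IsImaginaryQuadratic K ∧ 4 < (NumberField.discr K).natAbs ∧
        Literature.NumberTheory.EllipticCurves.SatisfiesHeegnerHypothesis (W.conductorNorm ℤ) K ∧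
        (W.quadraticTwist (NumberField.discr K : ℚ)).entireLFunction 1 ≠ 0 ∧
        ¬ p ∣ NumberField.classNumber K) :
    ∀ (W : WeierstrassCurve ℚ) [W.IsElliptic] [W.IsGloballyMinimal] (p : ℕ) [Fact p.Prime]
      [NeZero (W.conductorNorm ℤ)], W.HasCM → W.analyticRank = 1 → 5 ≤ p →
      Literature.NumberTheory.EllipticCurves.Rank1Residual.CMInert W p →
      ¬ Literature.NumberTheory.EllipticCurves.Rank1Residual.Good W p →
      ∃ (K : Type) (_ : Field K) (_ : NumberField K),
        Literature.NumberTheory.EllipticCurves.IsImaginaryQuadratic K ∧ 4 < (NumberField.discr K).natAbs ∧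
        Literature.NumberTheory.EllipticCurves.SatisfiesHeegnerHypothesis (W.conductorNorm ℤ) K ∧
        (W.quadraticTwist (NumberField.discr K : ℚ)).entireLFunction 1 ≠ 0 ∧ ¬ p ∣ NumberField.classNumber K := by
  intro W _ _ p _ _ hCM hr hp5 hin hbad
  exact h3 W p hCM hr hp5 hin hbad (h2 h1 W p hCM hr hp5 hin hbad)

/-- **KS_R from the registered two-stub cut** (skeleton 43cf659541f04013 of stmt-BirchSwinnertonDyer-20713: `stub_KSR1` = the
class-number half of the Heegner-field supply, unbounded in `|d_K|`; `stub_KSR2` = the twist coupling inside that family), both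
stated BY VALUE; = the skeleton's composition, landed as a theorem so that a split «KSR1 · KSR2» can also be filed `--glue-by`.
[cite: GrossZagier1986, §I.1] -/
theorem heegnerFieldSupplyCMInertBadKPrime_of_stubs
    (h1 : ∀ (W : WeierstrassCurve ℚ) [W.IsElliptic] [W.IsGloballyMinimal] (p : ℕ) [Fact p.Prime]
      [NeZero (W.conductorNorm ℤ)], W.HasCM → W.analyticRank = 1 → 5 ≤ p →
      Literature.NumberTheory.EllipticCurves.Rank1Residual.CMInert W p →
      ¬ Literature.NumberTheory.EllipticCurves.Rank1Residual.Good W p →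
      ∀ B : ℕ, ∃ (K : Type) (_ : Field K) (_ : NumberField K),
        Literature.NumberTheory.EllipticCurves.IsImaginaryQuadratic K ∧ B < (NumberField.discr K).natAbs ∧
        4 < (NumberField.discr K).natAbs ∧
        Literature.NumberTheory.EllipticCurves.SatisfiesHeegnerHypothesis (W.conductorNorm ℤ) K ∧
        ¬ p ∣ NumberField.classNumber K)
    (h2 : ∀ (W : WeierstrassCurve ℚ) [W.IsElliptic] [W.IsGloballyMinimal] (p : ℕ) [Fact p.Prime]
      [NeZero (W.conductorNorm ℤ)],
      W.HasCM → W.analyticRank = 1 → 5 ≤ p →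
      Literature.NumberTheory.EllipticCurves.Rank1Residual.CMInert W p →
      ¬ Literature.NumberTheory.EllipticCurves.Rank1Residual.Good W p →
      (∀ B : ℕ, ∃ (K : Type) (_ : Field K) (_ : NumberField K),
        Literature.NumberTheory.EllipticCurves.IsImaginaryQuadratic K ∧ B < (NumberField.discr K).natAbs ∧
        4 < (NumberField.discr K).natAbs ∧
        Literature.NumberTheory.EllipticCurves.SatisfiesHeegnerHypothesis (W.conductorNorm ℤ) K ∧
        ¬ p ∣ NumberField.classNumber K) →
      ∃ (K : Type) (_ : Field K) (_ : NumberField K),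
        Literature.NumberTheory.EllipticCurves.IsImaginaryQuadratic K ∧ 4 < (NumberField.discr K).natAbs ∧
        Literature.NumberTheory.EllipticCurves.SatisfiesHeegnerHypothesis (W.conductorNorm ℤ) K ∧
        (W.quadraticTwist (NumberField.discr K : ℚ)).entireLFunction 1 ≠ 0 ∧
        ¬ p ∣ NumberField.classNumber K) :
    ∀ (W : WeierstrassCurve ℚ) [W.IsElliptic] [W.IsGloballyMinimal] (p : ℕ) [Fact p.Prime]
      [NeZero (W.conductorNorm ℤ)], W.HasCM → W.analyticRank = 1 → 5 ≤ p →
      Literature.NumberTheory.EllipticCurves.Rank1Residual.CMInert W p →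
      ¬ Literature.NumberTheory.EllipticCurves.Rank1Residual.Good W p →
      ∃ (K : Type) (_ : Field K) (_ : NumberField K),
        Literature.NumberTheory.EllipticCurves.IsImaginaryQuadratic K ∧ 4 < (NumberField.discr K).natAbs ∧
        Literature.NumberTheory.EllipticCurves.SatisfiesHeegnerHypothesis (W.conductorNorm ℤ) K ∧
        (W.quadraticTwist (NumberField.discr K : ℚ)).entireLFunction 1 ≠ 0 ∧ ¬ p ∣ NumberField.classNumber K := by
  intro W _ _ p _ _ hCM hr hp5 hin hbad
  exact h2 W p hCM hr hp5 hin hbad (h1 W p hCM hr hp5 hin hbad)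

end Summit.BirchSwinnertonDyer.BirchSwinnertonDyer.Theorems.BiquadraticEisensteinDescentHeegnerFieldSupplyKPrimeOfChildren

end
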